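import Summits.AtomisticToContinuum.Crystallization.Theorems.HullExactificationCascadeRobustBarlowTemplateHoneycombContinuousA

/-!
# Honeycomb lemmas, part 2b (continuity of the piecewise-affine extension) for line `registered` (crux `RobustBarlowTemplate`, stmt-AtomisticToContinuum-12088)

Toward the registered stub `develop_injective`: the piecewise-affine extension `plExtend s g` of
vertex data `g` (values in any topological real vector space) over the refined Barlow honeycomb of a
Hägg stacking `s` is CONTINUOUS on `ℝ³` (`honeycomb_plExtend_continuous_of`; registered `E3`-valued
form `honeycomb_plExtend_continuous`).

Proof: by `…HoneycombContinuousA.lean` the extension is ONE affine function of the (continuous) skew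
coordinates on each closed cell, hence continuous on each closed cell; the six cells of a prism are
closed and cover it (pasting, `ContinuousOn.union_of_isClosed`); the closed prisms of slab `k` are the
preimages under `toSkew s k` of the boxes `[i, i+1] × [j, j+1] × [0, 1]`, a locally finite closed
family covering the closed slab `k ≤ x₃ / h ≤ k + 1` (`LocallyFinite.continuousOn_iUnion`); the closed
slabs form a locally finite closed cover of `ℝ³` (`LocallyFinite.continuous`).

## Contents
* `honeycomb_cellUp/Down/AB/EA/BF/FE_continuousOn` — each closed cell is closed and the extension is
  continuous on it;
* `honeycomb_prism_continuousOn`, `honeycomb_slab_continuousOn` — pasting;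
* `honeycomb_locallyFinite_Icc`, `honeycomb_locallyFinite_box` — local finiteness of unit intervals /
  boxes;
* `honeycomb_plExtend_continuous_of` (any `W`), `honeycomb_plExtend_continuous` (registered, `E3`).
-/

noncomputable section

namespace Summit.AtomisticToContinuum.Crystallization.Theorems.HullExactificationCascadeRobustBarlowTemplate

open Literature.MathematicalPhysics.StatisticalMechanics

/-- Euclidean `3`-space. -/
local notation "E3" => EuclideanSpace ℝ (Fin 3)

/-! ## Cells, prisms, slabs -/

section Continuity

variable {W : Type*} [AddCommGroup W] [Module ℝ W] [TopologicalSpace W] [ContinuousAdd W]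
  [ContinuousSMul ℝ W]

/-- The coordinate functions of `toSkew s k` are continuous. -/
theorem honeycomb_continuous_toSkew_apply (s : ℤ → ℤ) (k : ℤ) (n : Fin 3) :
    Continuous fun x : E3 => toSkew s k x n :=
  (continuous_apply n).comp (honeycomb_continuous_toSkew s k)

/-- A point in terms of its local skew coordinates relative to `(i, j)`. -/
theorem honeycomb_ofSkew_shift {s : ℤ → ℤ} {k : ℤ} (hsk : s k = 1 ∨ s k = -1) (x : E3) (i j : ℤ) :
    ofSkew s k ![(i : ℝ) + (toSkew s k x 0 - i), (j : ℝ) + (toSkew s k x 1 - j), toSkew s k x 2] = x := by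
  conv_rhs => rw [← honeycomb_ofSkew_toSkew s k hsk x]
  congr 1
  ext n
  fin_cases n <;> simp

/-- Cell `T↑` of prism `(k, i, j)` is closed and the extension is continuous on it. -/
theorem honeycomb_cellUp_continuousOn {s : ℤ → ℤ} (hs : IsHaggSeq s) (g : ℤ × ℤ × ℤ → W)
    (k i j : ℤ) :
    IsClosed {x : E3 | 0 ≤ toSkew s k x 0 - i ∧ 0 ≤ toSkew s k x 1 - j ∧ 0 ≤ toSkew s k x 2 ∧
        (toSkew s k x 0 - i) + (toSkew s k x 1 - j) + toSkew s k x 2 ≤ 1} ∧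
      ContinuousOn (plExtend s g)
        {x : E3 | 0 ≤ toSkew s k x 0 - i ∧ 0 ≤ toSkew s k x 1 - j ∧ 0 ≤ toSkew s k x 2 ∧
          (toSkew s k x 0 - i) + (toSkew s k x 1 - j) + toSkew s k x 2 ≤ 1} := by
  have h0 := honeycomb_continuous_toSkew_apply s k 0
  have h1 := honeycomb_continuous_toSkew_apply s k 1
  have h2 := honeycomb_continuous_toSkew_apply s k 2
  refine ⟨?_, ?_⟩
  · simp only [Set.setOf_and]
    refine IsClosed.inter (isClosed_le ?_ ?_) (IsClosed.inter (isClosed_le ?_ ?_)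
      (IsClosed.inter (isClosed_le ?_ ?_) (isClosed_le ?_ ?_))) <;> fun_prop
  refine (Continuous.continuousOn (s := Set.univ) (f := fun x : E3 =>
      (1 - (toSkew s k x 0 - i) - (toSkew s k x 1 - j) - toSkew s k x 2) • g (skewSite s k i j 0) +
        (toSkew s k x 0 - i) • g (skewSite s k (i + 1) j 0) +
        (toSkew s k x 1 - j) • g (skewSite s k i (j + 1) 0) +
        toSkew s k x 2 • g (skewSite s k i j 1)) (by fun_prop)).mono (Set.subset_univ _) |>.congr ?_
  rintro x ⟨ha, hb, hθ, h1'⟩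
  dsimp only
  conv_lhs => rw [← honeycomb_ofSkew_shift (hs k) x i j]
  exact honeycomb_plExtend_cellUp hs g k i j _ _ _ ha hb hθ h1'

/-- Cell `T↓` of prism `(k, i, j)` is closed and the extension is continuous on it. -/
theorem honeycomb_cellDown_continuousOn {s : ℤ → ℤ} (hs : IsHaggSeq s) (g : ℤ × ℤ × ℤ → W)
    (k i j : ℤ) :
    IsClosed {x : E3 | (toSkew s k x 0 - i) ≤ 1 ∧ (toSkew s k x 1 - j) ≤ 1 ∧ toSkew s k x 2 ≤ 1 ∧ 2 ≤ (toSkew s k x 0 - i) + (toSkew s k x 1 - j) + toSkew s k x 2} ∧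
      ContinuousOn (plExtend s g) {x : E3 | (toSkew s k x 0 - i) ≤ 1 ∧ (toSkew s k x 1 - j) ≤ 1 ∧ toSkew s k x 2 ≤ 1 ∧ 2 ≤ (toSkew s k x 0 - i) + (toSkew s k x 1 - j) + toSkew s k x 2} := by
  have h0 := honeycomb_continuous_toSkew_apply s k 0
  have h1 := honeycomb_continuous_toSkew_apply s k 1
  have h2 := honeycomb_continuous_toSkew_apply s k 2
  refine ⟨?_, ?_⟩
  · simp only [Set.setOf_and]
    refine IsClosed.inter (isClosed_le ?_ ?_) (IsClosed.inter (isClosed_le ?_ ?_)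
      (IsClosed.inter (isClosed_le ?_ ?_) (isClosed_le ?_ ?_))) <;> fun_prop
  refine (Continuous.continuousOn (s := Set.univ) (f := fun x : E3 =>
      (1 - toSkew s k x 2) • g (skewSite s k (i + 1) (j + 1) 0) + (1 - (toSkew s k x 1 - j)) • g (skewSite s k (i + 1) j 1) +
        (1 - (toSkew s k x 0 - i)) • g (skewSite s k i (j + 1) 1) +
        ((toSkew s k x 0 - i) + (toSkew s k x 1 - j) + toSkew s k x 2 - 2) • g (skewSite s k (i + 1) (j + 1) 1)) (by fun_prop)).mono (Set.subset_univ _) |>.congr ?_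
  rintro x ⟨c1, c2, c3, c4⟩
  dsimp only
  conv_lhs => rw [← honeycomb_ofSkew_shift (hs k) x i j]
  exact honeycomb_plExtend_cellDown hs g k i j _ _ _ c1 c2 c3 c4

/-- Quarter `{C, D, A, B}` of prism `(k, i, j)` is closed and the extension is continuous on it. -/
theorem honeycomb_cellAB_continuousOn {s : ℤ → ℤ} (hs : IsHaggSeq s) (g : ℤ × ℤ × ℤ → W)
    (k i j : ℤ) :
    IsClosed {x : E3 | 0 ≤ toSkew s k x 2 ∧ 1 ≤ (toSkew s k x 0 - i) + (toSkew s k x 1 - j) + toSkew s k x 2 ∧ (toSkew s k x 1 - j) + toSkew s k x 2 ≤ 1 ∧ (toSkew s k x 0 - i) + toSkew s k x 2 ≤ 1} ∧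
      ContinuousOn (plExtend s g) {x : E3 | 0 ≤ toSkew s k x 2 ∧ 1 ≤ (toSkew s k x 0 - i) + (toSkew s k x 1 - j) + toSkew s k x 2 ∧ (toSkew s k x 1 - j) + toSkew s k x 2 ≤ 1 ∧ (toSkew s k x 0 - i) + toSkew s k x 2 ≤ 1} := by
  have h0 := honeycomb_continuous_toSkew_apply s k 0
  have h1 := honeycomb_continuous_toSkew_apply s k 1
  have h2 := honeycomb_continuous_toSkew_apply s k 2
  refine ⟨?_, ?_⟩
  · simp only [Set.setOf_and]
    refine IsClosed.inter (isClosed_le ?_ ?_) (IsClosed.inter (isClosed_le ?_ ?_)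
      (IsClosed.inter (isClosed_le ?_ ?_) (isClosed_le ?_ ?_))) <;> fun_prop
  refine (Continuous.continuousOn (s := Set.univ) (f := fun x : E3 =>
      ((toSkew s k x 0 - i) + (toSkew s k x 1 - j) + toSkew s k x 2 - 1) • g (skewSite s k (i + 1) (j + 1) 0) + toSkew s k x 2 • g (skewSite s k i j 1) +
        (1 - (toSkew s k x 1 - j) - toSkew s k x 2) • g (skewSite s k (i + 1) j 0) +
        (1 - (toSkew s k x 0 - i) - toSkew s k x 2) • g (skewSite s k i (j + 1) 0)) (by fun_prop)).mono (Set.subset_univ _) |>.congr ?_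
  rintro x ⟨c1, c2, c3, c4⟩
  dsimp only
  conv_lhs => rw [← honeycomb_ofSkew_shift (hs k) x i j]
  exact honeycomb_plExtend_cellAB hs g k i j _ _ _ c1 c2 c3 c4

/-- Quarter `{C, D, E, A}` of prism `(k, i, j)` is closed and the extension is continuous on it. -/
theorem honeycomb_cellEA_continuousOn {s : ℤ → ℤ} (hs : IsHaggSeq s) (g : ℤ × ℤ × ℤ → W)
    (k i j : ℤ) :
    IsClosed {x : E3 | 0 ≤ (toSkew s k x 1 - j) ∧ (toSkew s k x 0 - i) ≤ 1 ∧ (toSkew s k x 1 - j) + toSkew s k x 2 ≤ 1 ∧ 1 ≤ (toSkew s k x 0 - i) + toSkew s k x 2} ∧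
      ContinuousOn (plExtend s g) {x : E3 | 0 ≤ (toSkew s k x 1 - j) ∧ (toSkew s k x 0 - i) ≤ 1 ∧ (toSkew s k x 1 - j) + toSkew s k x 2 ≤ 1 ∧ 1 ≤ (toSkew s k x 0 - i) + toSkew s k x 2} := by
  have h0 := honeycomb_continuous_toSkew_apply s k 0
  have h1 := honeycomb_continuous_toSkew_apply s k 1
  have h2 := honeycomb_continuous_toSkew_apply s k 2
  refine ⟨?_, ?_⟩
  · simp only [Set.setOf_and]
    refine IsClosed.inter (isClosed_le ?_ ?_) (IsClosed.inter (isClosed_le ?_ ?_)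
      (IsClosed.inter (isClosed_le ?_ ?_) (isClosed_le ?_ ?_))) <;> fun_prop
  refine (Continuous.continuousOn (s := Set.univ) (f := fun x : E3 =>
      (toSkew s k x 1 - j) • g (skewSite s k (i + 1) (j + 1) 0) + (1 - (toSkew s k x 0 - i)) • g (skewSite s k i j 1) +
        ((toSkew s k x 0 - i) + toSkew s k x 2 - 1) • g (skewSite s k (i + 1) j 1) +
        (1 - (toSkew s k x 1 - j) - toSkew s k x 2) • g (skewSite s k (i + 1) j 0)) (by fun_prop)).mono (Set.subset_univ _) |>.congr ?_
  rintro x ⟨c1, c2, c3, c4⟩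
  dsimp only
  conv_lhs => rw [← honeycomb_ofSkew_shift (hs k) x i j]
  exact honeycomb_plExtend_cellEA hs g k i j _ _ _ c1 c2 c3 c4

/-- Quarter `{C, D, B, F}` of prism `(k, i, j)` is closed and the extension is continuous on it. -/
theorem honeycomb_cellBF_continuousOn {s : ℤ → ℤ} (hs : IsHaggSeq s) (g : ℤ × ℤ × ℤ → W)
    (k i j : ℤ) :
    IsClosed {x : E3 | 0 ≤ (toSkew s k x 0 - i) ∧ (toSkew s k x 1 - j) ≤ 1 ∧ 1 ≤ (toSkew s k x 1 - j) + toSkew s k x 2 ∧ (toSkew s k x 0 - i) + toSkew s k x 2 ≤ 1} ∧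
      ContinuousOn (plExtend s g) {x : E3 | 0 ≤ (toSkew s k x 0 - i) ∧ (toSkew s k x 1 - j) ≤ 1 ∧ 1 ≤ (toSkew s k x 1 - j) + toSkew s k x 2 ∧ (toSkew s k x 0 - i) + toSkew s k x 2 ≤ 1} := by
  have h0 := honeycomb_continuous_toSkew_apply s k 0
  have h1 := honeycomb_continuous_toSkew_apply s k 1
  have h2 := honeycomb_continuous_toSkew_apply s k 2
  refine ⟨?_, ?_⟩
  · simp only [Set.setOf_and]
    refine IsClosed.inter (isClosed_le ?_ ?_) (IsClosed.inter (isClosed_le ?_ ?_)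
      (IsClosed.inter (isClosed_le ?_ ?_) (isClosed_le ?_ ?_))) <;> fun_prop
  refine (Continuous.continuousOn (s := Set.univ) (f := fun x : E3 =>
      (toSkew s k x 0 - i) • g (skewSite s k (i + 1) (j + 1) 0) + (1 - (toSkew s k x 1 - j)) • g (skewSite s k i j 1) +
        (1 - (toSkew s k x 0 - i) - toSkew s k x 2) • g (skewSite s k i (j + 1) 0) +
        ((toSkew s k x 1 - j) + toSkew s k x 2 - 1) • g (skewSite s k i (j + 1) 1)) (by fun_prop)).mono (Set.subset_univ _) |>.congr ?_
  rintro x ⟨c1, c2, c3, c4⟩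
  dsimp only
  conv_lhs => rw [← honeycomb_ofSkew_shift (hs k) x i j]
  exact honeycomb_plExtend_cellBF hs g k i j _ _ _ c1 c2 c3 c4

/-- Quarter `{C, D, F, E}` of prism `(k, i, j)` is closed and the extension is continuous on it. -/
theorem honeycomb_cellFE_continuousOn {s : ℤ → ℤ} (hs : IsHaggSeq s) (g : ℤ × ℤ × ℤ → W)
    (k i j : ℤ) :
    IsClosed {x : E3 | toSkew s k x 2 ≤ 1 ∧ (toSkew s k x 0 - i) + (toSkew s k x 1 - j) + toSkew s k x 2 ≤ 2 ∧ 1 ≤ (toSkew s k x 1 - j) + toSkew s k x 2 ∧ 1 ≤ (toSkew s k x 0 - i) + toSkew s k x 2} ∧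
      ContinuousOn (plExtend s g) {x : E3 | toSkew s k x 2 ≤ 1 ∧ (toSkew s k x 0 - i) + (toSkew s k x 1 - j) + toSkew s k x 2 ≤ 2 ∧ 1 ≤ (toSkew s k x 1 - j) + toSkew s k x 2 ∧ 1 ≤ (toSkew s k x 0 - i) + toSkew s k x 2} := by
  have h0 := honeycomb_continuous_toSkew_apply s k 0
  have h1 := honeycomb_continuous_toSkew_apply s k 1
  have h2 := honeycomb_continuous_toSkew_apply s k 2
  refine ⟨?_, ?_⟩
  · simp only [Set.setOf_and]
    refine IsClosed.inter (isClosed_le ?_ ?_) (IsClosed.inter (isClosed_le ?_ ?_)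
      (IsClosed.inter (isClosed_le ?_ ?_) (isClosed_le ?_ ?_))) <;> fun_prop
  refine (Continuous.continuousOn (s := Set.univ) (f := fun x : E3 =>
      (1 - toSkew s k x 2) • g (skewSite s k (i + 1) (j + 1) 0) + (2 - (toSkew s k x 0 - i) - (toSkew s k x 1 - j) - toSkew s k x 2) • g (skewSite s k i j 1) +
        ((toSkew s k x 1 - j) + toSkew s k x 2 - 1) • g (skewSite s k i (j + 1) 1) +
        ((toSkew s k x 0 - i) + toSkew s k x 2 - 1) • g (skewSite s k (i + 1) j 1)) (by fun_prop)).mono (Set.subset_univ _) |>.congr ?_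
  rintro x ⟨c1, c2, c3, c4⟩
  dsimp only
  conv_lhs => rw [← honeycomb_ofSkew_shift (hs k) x i j]
  exact honeycomb_plExtend_cellFE hs g k i j _ _ _ c1 c2 c3 c4

/-- The extension is continuous on the closed prism `[i, i+1] × [j, j+1] × [0, 1]` of slab `k`
(pasting of the six closed cells). -/
theorem honeycomb_prism_continuousOn {s : ℤ → ℤ} (hs : IsHaggSeq s) (g : ℤ × ℤ × ℤ → W)
    (k i j : ℤ) :
    ContinuousOn (plExtend s g)
      {x : E3 | 0 ≤ (toSkew s k x 0 - i) ∧ (toSkew s k x 0 - i) ≤ 1 ∧ 0 ≤ (toSkew s k x 1 - j) ∧ (toSkew s k x 1 - j) ≤ 1 ∧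
        0 ≤ toSkew s k x 2 ∧ toSkew s k x 2 ≤ 1} := by
  obtain ⟨c0, f0⟩ := honeycomb_cellUp_continuousOn hs g k i j
  obtain ⟨c1, f1⟩ := honeycomb_cellDown_continuousOn hs g k i j
  obtain ⟨c2, f2⟩ := honeycomb_cellAB_continuousOn hs g k i j
  obtain ⟨c3, f3⟩ := honeycomb_cellEA_continuousOn hs g k i j
  obtain ⟨c4, f4⟩ := honeycomb_cellBF_continuousOn hs g k i j
  obtain ⟨c5, f5⟩ := honeycomb_cellFE_continuousOn hs g k i j
  refine (((((f0.union_of_isClosed f1 c0 c1).union_of_isClosed f2 (c0.union c1) c2).union_of_isClosed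
    f3 ((c0.union c1).union c2) c3).union_of_isClosed f4 (((c0.union c1).union c2).union c3)
    c4).union_of_isClosed f5 ((((c0.union c1).union c2).union c3).union c4) c5).mono ?_
  rintro x ⟨ha0, ha1, hb0, hb1, hθ0, hθ1⟩
  simp only [Set.mem_union, Set.mem_setOf_eq]
  by_cases k1 : (toSkew s k x 0 - i) + (toSkew s k x 1 - j) + toSkew s k x 2 ≤ 1
  · exact Or.inl (Or.inl (Or.inl (Or.inl (Or.inl ⟨ha0, hb0, hθ0, k1⟩))))
  by_cases k2 : 2 ≤ (toSkew s k x 0 - i) + (toSkew s k x 1 - j) + toSkew s k x 2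
  · exact Or.inl (Or.inl (Or.inl (Or.inl (Or.inr ⟨ha1, hb1, hθ1, k2⟩))))
  by_cases k3 : (toSkew s k x 1 - j) + toSkew s k x 2 ≤ 1
  · by_cases k4 : (toSkew s k x 0 - i) + toSkew s k x 2 ≤ 1
    · exact Or.inl (Or.inl (Or.inl (Or.inr ⟨hθ0, by linarith, k3, k4⟩)))
    · exact Or.inl (Or.inl (Or.inr ⟨hb0, ha1, k3, by linarith⟩))
  · by_cases k4 : (toSkew s k x 0 - i) + toSkew s k x 2 ≤ 1
    · exact Or.inl (Or.inr ⟨ha0, hb1, by linarith, k4⟩)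
    · exact Or.inr ⟨hθ1, by linarith, by linarith, by linarith⟩

/-- The unit intervals `[n, n+1]`, `n ∈ ℤ`, form a locally finite family. -/
theorem honeycomb_locallyFinite_Icc : LocallyFinite fun n : ℤ => Set.Icc (n : ℝ) (n + 1) := by
  intro t
  refine ⟨Set.Ioo (t - 1) (t + 1), Ioo_mem_nhds (by linarith) (by linarith), ?_⟩
  refine (Set.finite_Icc (⌊t⌋ - 1) (⌊t⌋ + 1)).subset ?_
  rintro n ⟨y, ⟨hy0, hy1⟩, hy2, hy3⟩
  have hf0 := Int.floor_le t
  have hf1 := Int.lt_floor_add_one t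
  have e1 : ((⌊t⌋ - 1 : ℤ) : ℝ) < n + 1 := by push_cast; linarith
  have e2 : (n : ℝ) < ((⌊t⌋ + 1 : ℤ) : ℝ) + 1 := by push_cast; linarith
  exact ⟨by exact_mod_cast Int.lt_add_one_iff.1 (by exact_mod_cast e1),
    by exact_mod_cast Int.lt_add_one_iff.1 (by exact_mod_cast e2)⟩

/-- The boxes `[i, i+1] × [j, j+1]` (in the first two of three real coordinates) form a locally
finite family. -/
theorem honeycomb_locallyFinite_box :
    LocallyFinite fun p : ℤ × ℤ =>
      {c : Fin 3 → ℝ | (p.1 : ℝ) ≤ c 0 ∧ c 0 ≤ p.1 + 1 ∧ (p.2 : ℝ) ≤ c 1 ∧ c 1 ≤ p.2 + 1} := by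
  have e0 : Continuous fun c : Fin 3 → ℝ => c 0 := continuous_apply 0
  have e1 : Continuous fun c : Fin 3 → ℝ => c 1 := continuous_apply 1
  have hA := honeycomb_locallyFinite_Icc.preimage_continuous e0
  have hB := honeycomb_locallyFinite_Icc.preimage_continuous e1
  intro c
  obtain ⟨u, hu, hfu⟩ := hA c
  obtain ⟨v, hv, hfv⟩ := hB c
  refine ⟨u ∩ v, Filter.inter_mem hu hv, (hfu.prod hfv).subset ?_⟩
  rintro ⟨i, j⟩ ⟨y, ⟨hy0, hy1, hy2, hy3⟩, hyu, hyv⟩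
  exact ⟨⟨y, ⟨hy0, hy1⟩, hyu⟩, ⟨y, ⟨hy2, hy3⟩, hyv⟩⟩

/-- The extension is continuous on each closed slab `k ≤ x₃ / h ≤ k + 1`. -/
theorem honeycomb_slab_continuousOn {s : ℤ → ℤ} (hs : IsHaggSeq s) (g : ℤ × ℤ × ℤ → W) (k : ℤ) :
    ContinuousOn (plExtend s g) {x : E3 | (k : ℝ) ≤ x 2 / hB ∧ x 2 / hB ≤ k + 1} := by
  have hc := honeycomb_continuous_toSkew s k
  -- the closed prisms of slab `k`, a locally finite closed family
  have hLF : LocallyFinite fun p : ℤ × ℤ =>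
      {x : E3 | 0 ≤ toSkew s k x 0 - p.1 ∧ toSkew s k x 0 - p.1 ≤ 1 ∧ 0 ≤ toSkew s k x 1 - p.2 ∧
        toSkew s k x 1 - p.2 ≤ 1 ∧ 0 ≤ toSkew s k x 2 ∧ toSkew s k x 2 ≤ 1} := by
    refine (honeycomb_locallyFinite_box.preimage_continuous hc).subset ?_
    rintro ⟨i, j⟩ x ⟨h0, h1, h2, h3, -, -⟩
    exact ⟨by simpa using h0, by simp; linarith, by simpa using h2, by simp; linarith⟩
  have hcl : ∀ p : ℤ × ℤ, IsClosed
      {x : E3 | 0 ≤ toSkew s k x 0 - p.1 ∧ toSkew s k x 0 - p.1 ≤ 1 ∧ 0 ≤ toSkew s k x 1 - p.2 ∧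
        toSkew s k x 1 - p.2 ≤ 1 ∧ 0 ≤ toSkew s k x 2 ∧ toSkew s k x 2 ≤ 1} := by
    intro p
    have h0 := honeycomb_continuous_toSkew_apply s k 0
    have h1 := honeycomb_continuous_toSkew_apply s k 1
    have h2 := honeycomb_continuous_toSkew_apply s k 2
    simp only [Set.setOf_and]
    refine IsClosed.inter (isClosed_le ?_ ?_) (IsClosed.inter (isClosed_le ?_ ?_)
      (IsClosed.inter (isClosed_le ?_ ?_) (IsClosed.inter (isClosed_le ?_ ?_)
      (IsClosed.inter (isClosed_le ?_ ?_) (isClosed_le ?_ ?_))))) <;> fun_prop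
  refine (hLF.continuousOn_iUnion hcl fun p => honeycomb_prism_continuousOn hs g k p.1 p.2).mono ?_
  rintro x ⟨hk0, hk1⟩
  have hθ : toSkew s k x 2 = x 2 / hB - k := honeycomb_toSkew_apply_two s k x
  refine Set.mem_iUnion.2 ⟨(⌊toSkew s k x 0⌋, ⌊toSkew s k x 1⌋), ?_⟩
  have a0 := Int.floor_le (toSkew s k x 0)
  have a1 := Int.lt_floor_add_one (toSkew s k x 0)
  have b0 := Int.floor_le (toSkew s k x 1)
  have b1 := Int.lt_floor_add_one (toSkew s k x 1)
  exact ⟨by linarith, by linarith, by linarith, by linarith, by linarith, by linarith⟩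

/-- CONTINUITY OF THE PIECEWISE-AFFINE EXTENSION (any topological vector space of values):
pasting over the locally finite closed cover of `ℝ³` by slabs, prisms and cells. -/
theorem honeycomb_plExtend_continuous_of {s : ℤ → ℤ} (hs : IsHaggSeq s) (g : ℤ × ℤ × ℤ → W) :
    Continuous (plExtend s g) := by
  have hcoord : Continuous fun x : E3 => x 2 / hB := by fun_prop
  have hLF : LocallyFinite fun k : ℤ => {x : E3 | (k : ℝ) ≤ x 2 / hB ∧ x 2 / hB ≤ k + 1} :=
    honeycomb_locallyFinite_Icc.preimage_continuous hcoord
  refine hLF.continuous ?_ (fun k => ?_) (fun k => honeycomb_slab_continuousOn hs g k)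
  · refine Set.eq_univ_of_forall fun x => Set.mem_iUnion.2 ⟨⌊x 2 / hB⌋, ?_⟩
    exact ⟨Int.floor_le _, (Int.lt_floor_add_one _).le⟩
  · simp only [Set.setOf_and]
    exact (isClosed_le continuous_const hcoord).inter (isClosed_le hcoord (by fun_prop))

end Continuity

/-- SUB-GOAL (registered): the piecewise-affine extension of `E3`-valued vertex data over the refined
Barlow honeycomb is continuous. -/
theorem honeycomb_plExtend_continuous :
    ∀ (s : ℤ → ℤ), IsHaggSeq s → ∀ (g : ℤ × ℤ × ℤ → E3), Continuous (plExtend s g) :=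
  fun _ hs g => honeycomb_plExtend_continuous_of hs g

end Summit.AtomisticToContinuum.Crystallization.Theorems.HullExactificationCascadeRobustBarlowTemplate

end
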